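import Literature.NumberTheory.LFunctions.KMVPrimeAveragedDiagOnly
import Literature.NumberTheory.LFunctions.KloostermanFractionsAmplifier
import HarnessLib

/-!
# Route `PrimeLevelFamEdge`, crux K_B (stmt-Parity-20343), line `diagonal_kernel_split` rev 4, plan Ω,
# sub-line Ω-h (glue prerequisite) — **every large dyadic block `(N, 2N]` contains a good prime**

The clean-scale entry point of the heart (`PeterssonSplit.offDiagBelowSlack_io_of_blockAtCleanScales_pointwise`,
p634449) asks, at each clean scale `N`, for `(goodPrimes Δ′ N).Nonempty` together with the block inequality; the
clean scales are produced by Landau–Page (`cleanScales_io_explicit`) and are not ours to choose, so plan Ω needs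
non-emptiness for ALL large `N`, not merely for unboundedly many (`KMV2000.exists_goodPrimes_nonempty`). This file
proves it for every `0 < Δ′ < 2`:

* `card_badPrimes_le` — the primes `q ∈ (N,2N]` with `q̂^{Δ′} ∈ ℕ` number at most `(2N)^{Δ′/2}`
  (`q ↦ q̂^{Δ′}` is injective and `1 ≤ q̂^{Δ′} ≤ (2N)^{Δ′/2}` on them);
* `card_primes_block_ge` — `#{q prime ∈ (N,2N]} ≥ N/(2 log N)` eventually (tree: `DFI_card_primes_Ioc_ge`, Chebyshev/PNT);
* **`goodPrimes_nonempty_eventually`** — `∃ N₀, ∀ N ≥ N₀, (goodPrimes Δ′ N).Nonempty`, since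
  `(2N)^{Δ′/2} < N/(2 log N)` eventually for `Δ′ < 2`.

Elementary; theorems only; standard axioms. Helper toward `stub_offDiagBelowSlack_io`; closes nothing.
«The programme SEARCHES and TYPES; no claim about Landau–Siegel zeros, Theorems 1–2 of arXiv:2211.02515 or
a repaired Margin232 until a kernel theorem says so.»
-/

noncomputable section

open Finset Filter
open scoped Real Topology

namespace Summit.Parity.GeneralizedHardyLittlewood.Theorems.BeyondDiagonalBeatsQuarter.OffDiag

open Literature.NumberTheory.LFunctions Literature.NumberTheory.LFunctions.KMV2000

open Classical in
/-- `goodPrimes Δ′ N` is the set of primes of `(N, 2N]` minus the «bad» ones (`q̂^{Δ′} ∈ ℕ`), as a filter of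
`(Ioc N (2N)).filter Nat.Prime`. [cite: KowalskiMichelVanderKam2000, §2 p. 7 (M ∉ ℤ)] -/
theorem goodPrimes_eq_filter (Δ' : ℝ) (N : ℕ) :
    goodPrimes Δ' N = ((Ioc N (2 * N)).filter Nat.Prime).filter
      (fun q : ℕ ↦ ∀ n : ℕ, (n : ℝ) ≠ (Real.sqrt (q : ℝ) / (2 * π)) ^ Δ') := by
  ext q
  simp only [mem_goodPrimes_iff, Finset.mem_filter, Finset.mem_Ioc]
  constructor
  · rintro ⟨h1, h2, h3, h4⟩; exact ⟨⟨⟨by omega, h2⟩, h3⟩, h4⟩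
  · rintro ⟨⟨⟨h1, h2⟩, h3⟩, h4⟩; exact ⟨by omega, h2, h3, h4⟩

/-- For `q ≤ 2N` and `Δ′ > 0`: `(√q/(2π))^{Δ′} ≤ (2N)^{Δ′/2}`. [folklore] -/
theorem qhat_rpow_le_of_le {q N : ℕ} (hq : q ≤ 2 * N) {Δ' : ℝ} (h0 : 0 < Δ') :
    (Real.sqrt (q : ℝ) / (2 * π)) ^ Δ' ≤ (2 * (N : ℝ)) ^ (Δ' / 2) := by
  have hπ : (1 : ℝ) ≤ 2 * π := by linarith [Real.pi_gt_three]
  have h1 : Real.sqrt (q : ℝ) / (2 * π) ≤ Real.sqrt (q : ℝ) := div_le_self (Real.sqrt_nonneg _) hπ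
  calc (Real.sqrt (q : ℝ) / (2 * π)) ^ Δ' ≤ (Real.sqrt (q : ℝ)) ^ Δ' :=
        Real.rpow_le_rpow (by positivity) h1 h0.le
    _ = (q : ℝ) ^ (Δ' / 2) := by
        rw [Real.sqrt_eq_rpow, ← Real.rpow_mul (Nat.cast_nonneg _)]; ring_nf
    _ ≤ (2 * (N : ℝ)) ^ (Δ' / 2) :=
        Real.rpow_le_rpow (Nat.cast_nonneg _) (by exact_mod_cast hq) (by linarith)

open Classical in
/-- **The bad primes of a block are few**: `#{q prime ∈ (N,2N] : q̂^{Δ′} ∈ ℕ} ≤ (2N)^{Δ′/2}` for `Δ′ > 0`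
(`q ↦ q̂^{Δ′}` is injective with values in `[1, (2N)^{Δ′/2}]`). [cite: KowalskiMichelVanderKam2000, §2 p. 7 (M ∉ ℤ) — derivation] -/
theorem card_badPrimes_le {Δ' : ℝ} (h0 : 0 < Δ') (N : ℕ) :
    ((((Ioc N (2 * N)).filter Nat.Prime).filter
        (fun q : ℕ ↦ ¬ ∀ n : ℕ, (n : ℝ) ≠ (Real.sqrt (q : ℝ) / (2 * π)) ^ Δ')).card : ℝ) ≤
      (2 * (N : ℝ)) ^ (Δ' / 2) := by
  set B := ((Ioc N (2 * N)).filter Nat.Prime).filter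
    (fun q : ℕ ↦ ¬ ∀ n : ℕ, (n : ℝ) ≠ (Real.sqrt (q : ℝ) / (2 * π)) ^ Δ') with hB
  -- members of `B`: primes `q ≤ 2N` with `q̂^{Δ′} = n ∈ ℕ`
  have hmem : ∀ q ∈ B, ∃ n : ℕ, (n : ℝ) = (Real.sqrt (q : ℝ) / (2 * π)) ^ Δ' ∧ q ≤ 2 * N ∧ 0 < q := by
    intro q hq
    simp only [hB, Finset.mem_filter, Finset.mem_Ioc, not_forall, not_not] at hq
    obtain ⟨⟨⟨-, h2⟩, hp⟩, n, hn⟩ := hq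
    exact ⟨n, hn, h2, hp.pos⟩
  -- the injection `q ↦ ⌊q̂^{Δ′}⌋₊` into `Icc 1 ⌊(2N)^{Δ′/2}⌋₊`
  have hmaps : ∀ q ∈ B, ⌊(Real.sqrt (q : ℝ) / (2 * π)) ^ Δ'⌋₊ ∈ Icc 1 ⌊(2 * (N : ℝ)) ^ (Δ' / 2)⌋₊ := by
    intro q hq
    obtain ⟨n, hn, h2N, hq0⟩ := hmem q hq
    rw [← hn, Nat.floor_natCast, Finset.mem_Icc]
    constructor
    · by_contra h
      have hn0 : n = 0 := by omega
      rw [hn0, Nat.cast_zero] at hn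
      have hq0' : (0 : ℝ) < q := by exact_mod_cast hq0
      have : 0 < (Real.sqrt (q : ℝ) / (2 * π)) ^ Δ' := Real.rpow_pos_of_pos (by positivity) _
      linarith
    · exact Nat.le_floor (hn ▸ qhat_rpow_le_of_le (q := q) (N := N) h2N h0)
  have hinj : Set.InjOn (fun q : ℕ ↦ ⌊(Real.sqrt (q : ℝ) / (2 * π)) ^ Δ'⌋₊) (B : Set ℕ) := by
    intro a ha b hb hab
    obtain ⟨na, hna, -, -⟩ := hmem a ha
    obtain ⟨nb, hnb, -, -⟩ := hmem b hb
    simp only at hab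
    rw [← hna, ← hnb, Nat.floor_natCast, Nat.floor_natCast] at hab
    subst hab
    have h : (Real.sqrt (a : ℝ) / (2 * π)) ^ Δ' = (Real.sqrt (b : ℝ) / (2 * π)) ^ Δ' := by rw [← hna, ← hnb]
    rw [Real.rpow_left_inj (by positivity) (by positivity) h0.ne',
      div_left_inj' (by positivity : (2 * π : ℝ) ≠ 0),
      Real.sqrt_inj (Nat.cast_nonneg _) (Nat.cast_nonneg _), Nat.cast_inj] at h
    exact h
  have hcard := Finset.card_le_card_of_injOn _ hmaps hinj
  calc (B.card : ℝ) ≤ ((Icc 1 ⌊(2 * (N : ℝ)) ^ (Δ' / 2)⌋₊).card : ℝ) := by exact_mod_cast hcard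
    _ = (⌊(2 * (N : ℝ)) ^ (Δ' / 2)⌋₊ : ℝ) := by rw [Nat.card_Icc]; push_cast; ring
    _ ≤ (2 * (N : ℝ)) ^ (Δ' / 2) := Nat.floor_le (by positivity)

/-- **For `0 < Δ′ < 2`, `(2N)^{Δ′/2} < N/(2 log N)` eventually.** [folklore] -/
theorem eventually_rpow_lt_div_log {Δ' : ℝ} (h2 : Δ' < 2) :
    ∀ᶠ N : ℕ in atTop, (2 * (N : ℝ)) ^ (Δ' / 2) < (N : ℝ) / (2 * Real.log N) := by
  have hδ : 0 < 1 - Δ' / 2 := by linarith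
  -- `log x ≤ (1/8) x^{1−Δ′/2}` eventually
  have hlog := (isLittleO_log_rpow_atTop hδ).bound (show (0 : ℝ) < 1 / 8 by norm_num)
  have hreal : ∀ᶠ x : ℝ in atTop, (2 * x) ^ (Δ' / 2) < x / (2 * Real.log x) := by
    filter_upwards [hlog, eventually_gt_atTop (1 : ℝ)] with x hx hx1
    have hx0 : 0 < x := by linarith
    have hlogpos : 0 < Real.log x := Real.log_pos hx1
    rw [Real.norm_of_nonneg hlogpos.le, Real.norm_of_nonneg (Real.rpow_nonneg hx0.le _)] at hx
    rw [lt_div_iff₀ (by positivity)]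
    have h2pow : (2 : ℝ) ^ (Δ' / 2) < 2 := by
      calc (2 : ℝ) ^ (Δ' / 2) < (2 : ℝ) ^ (1 : ℝ) :=
            Real.rpow_lt_rpow_of_exponent_lt (by norm_num) (by linarith)
        _ = 2 := Real.rpow_one 2
    have hsplit : (2 * x) ^ (Δ' / 2) = (2 : ℝ) ^ (Δ' / 2) * x ^ (Δ' / 2) :=
      Real.mul_rpow (by norm_num) hx0.le
    have hxx : x ^ (Δ' / 2) * x ^ (1 - Δ' / 2) = x := by
      rw [← Real.rpow_add hx0]; norm_num
    have hxpos : 0 < x ^ (Δ' / 2) := Real.rpow_pos_of_pos hx0 _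
    have h2pos : 0 < (2 : ℝ) ^ (Δ' / 2) := Real.rpow_pos_of_pos (by norm_num) _
    calc (2 * x) ^ (Δ' / 2) * (2 * Real.log x)
        = (2 : ℝ) ^ (Δ' / 2) * x ^ (Δ' / 2) * (2 * Real.log x) := by rw [hsplit]
      _ ≤ (2 : ℝ) ^ (Δ' / 2) * x ^ (Δ' / 2) * (2 * (1 / 8 * x ^ (1 - Δ' / 2))) := by gcongr
      _ = (2 : ℝ) ^ (Δ' / 2) / 4 * (x ^ (Δ' / 2) * x ^ (1 - Δ' / 2)) := by ring
      _ = (2 : ℝ) ^ (Δ' / 2) / 4 * x := by rw [hxx]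
      _ < x := by nlinarith
  exact tendsto_natCast_atTop_atTop.eventually hreal

open Classical in
/-- **Every large dyadic block contains a good prime**: for `0 < Δ′ < 2` there is `N₀` with
`(goodPrimes Δ′ N).Nonempty` for all `N ≥ N₀`. [cite: KowalskiMichelVanderKam2000, §2 p. 7 (M ∉ ℤ) — derivation] -/
theorem goodPrimes_nonempty_eventually {Δ' : ℝ} (h0 : 0 < Δ') (h2 : Δ' < 2) :
    ∃ N₀ : ℕ, ∀ N : ℕ, N₀ ≤ N → (goodPrimes Δ' N).Nonempty := by
  obtain ⟨L₀, hL₀⟩ := DFI_card_primes_Ioc_ge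
  obtain ⟨N₁, hN₁⟩ := eventually_atTop.mp (eventually_rpow_lt_div_log h2)
  refine ⟨max L₀ N₁, fun N hN ↦ ?_⟩
  have hP := hL₀ N (le_of_max_le_left hN)
  have hlt := hN₁ N (le_of_max_le_right hN)
  have hbad := card_badPrimes_le h0 N
  -- #good = #primes − #bad > 0
  set P := (Ioc N (2 * N)).filter Nat.Prime with hPdef
  have hsplit := Finset.card_filter_add_card_filter_not
    (s := P) (fun q : ℕ ↦ ∀ n : ℕ, (n : ℝ) ≠ (Real.sqrt (q : ℝ) / (2 * π)) ^ Δ')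
  rw [goodPrimes_eq_filter]
  refine Finset.card_pos.mp ?_
  have hreal : (0 : ℝ) <
      ((P.filter fun q : ℕ ↦ ∀ n : ℕ, (n : ℝ) ≠ (Real.sqrt (q : ℝ) / (2 * π)) ^ Δ').card : ℝ) := by
    have heq : ((P.filter fun q : ℕ ↦ ∀ n : ℕ, (n : ℝ) ≠ (Real.sqrt (q : ℝ) / (2 * π)) ^ Δ').card : ℝ) =
        (P.card : ℝ) -
          ((P.filter fun q : ℕ ↦ ¬ ∀ n : ℕ, (n : ℝ) ≠ (Real.sqrt (q : ℝ) / (2 * π)) ^ Δ').card : ℝ) := by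
      rw [← hsplit]; push_cast; ring
    rw [heq]
    linarith
  exact_mod_cast hreal

end Summit.Parity.GeneralizedHardyLittlewood.Theorems.BeyondDiagonalBeatsQuarter.OffDiag
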